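import Summits.BirchSwinnertonDyer.BirchSwinnertonDyer.Theorems.ErratumRoadFiveNonSurjCornerKolyJRedefinitionSharp
import HarnessLib

/-!
# Assembly of the swap supply: the `hswap` binder of `Koly.kolyvaginRedefinition_of_swap` ∕ `Koly.pDiv_of_swap_of_perLevel`
# FROM the family form delivered by `Koly.exists_deep_of_swapFamilies'` (and its corollaries) plus the EXISTENCE of
# Kolyvagin–Heegner data at admissible conductors (cell `bsd-stepL`, seat `bsd-stepL-corner-p1` g8;
# `--supports stmt-BirchSwinnertonDyer-19947`)

WHAT. The displays (`…KolyJRedefinitionSharp`, p514959) take `hswap` in the shape «for all `M e` and every admissible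
`(n, d)` over index `≥ M + 1` with `P_n ∉ p^{M+1}E`, all conductors over index `≥ M + 1` being `p^M`-divisible, there is an
admissible `(n', d')` over index `≥ e` with `P_{n'} ∉ p^{M+1}E`»; the instantiated swap (`…KolyJSwapRowPrime`, p510753;
corollaries p512423 ∕ p513987) delivers, for a FAMILY `D` of data on the admissible conductors of index `≥ M + 1`
satisfying the named inputs, «`¬ p^{M+1} ∣ P(D c) ⟹ ∃` deep `s`, `¬ p^{M+1} ∣ P(D s)`». This file is the bookkeeping
between the two: **`hswap_of_swapSupply`** — given data at every admissible conductor (`hdata`; in print: Heegner points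
of every conductor prime to `N`, Gross 1991 §3 — the tree has the conductor-`1` case `exists_kolyvaginHeegnerData_one`
from Darmon's Prop. 3.6 and keeps the general case as a binder, cf. `…KolyvaginRoadThreeTowerForm`) and the family-form
supply FOR EVERY FAMILY (`hsupply`), the `hswap` binder holds: put the given datum `d` into a chosen family by
`Function.update` and read off the deep conductor. One theorem, pure logic; nothing discharged; T7.
References: [GrossLMS1991] §3 (Heegner points of conductor n); [McCallumLMS1991] §5 Prop. 5.2; [BurungaleEtAl2026] Prop. 2.2.1.
-/

set_option autoImplicit false

noncomputable section

open scoped Classical NumberField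

namespace Summit.BirchSwinnertonDyer.Rank1Residual.X11b.Three.Koly

open WeierstrassCurve Literature.NumberTheory.EllipticCurves
  Literature.NumberTheory.EllipticCurves.ModularForms
  Literature.NumberTheory.EllipticCurves.Rank1Residual
  Summit.BirchSwinnertonDyer.Rank1Residual Summit.BirchSwinnertonDyer.Rank1Residual.X11b
  IsDedekindDomain NumberField

universe u

variable {N : ℕ} [NeZero N] {W : WeierstrassCurve ℚ} {K : Type u} [Field K] [NumberField K]
  {Dt : ModularParametrizationData W N} {β : ℤ} {ι : K →+* ℂ} [W.IsGloballyMinimal]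

/-- **`hswap` from the family-form swap supply and the existence of data at admissible conductors.** `hdata`: a
Kolyvagin–Heegner datum exists at every square-free conductor all of whose prime factors are Kolyvagin primes;
`hsupply`: for all `M e` and EVERY family `D` of data on the admissible conductors over index `≥ M + 1` whose derived
points are all `p^M`-divisible, a conductor `c` with `¬ p^{M+1} ∣ P(D c)` yields a conductor `s` over index `≥ e` with
`¬ p^{M+1} ∣ P(D s)` (= the conclusion of `exists_deep_of_swapFamilies'` for `D`, its named inputs granted). CONCLUSION: the
`hswap` binder of `kolyvaginRedefinition_of_swap` ∕ `pDiv_of_swap_of_perLevel`, VERBATIM. Pure logic.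
[cite: McCallumLMS1991, §5 Prop. 5.2 (p. 304)] [cite: GrossLMS1991, §3] -/
theorem hswap_of_swapSupply (p : ℕ)
    (hdata : ∀ m : ℕ, Squarefree m →
      (∀ q ∈ m.primeFactors, Zhang2014.IsKolyvaginPrime N W K p q) → Nonempty (KolyvaginHeegnerData Dt β ι m))
    (hsupply : ∀ (M e : ℕ)
      (D : ∀ s : {m : ℕ // Squarefree m ∧ ∀ q ∈ m.primeFactors,
          Zhang2014.IsKolyvaginPrime N W K p q ∧ M + 1 ≤ Zhang2014.kolyvaginIndex W p q},
        KolyvaginHeegnerData Dt β ι s.1),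
      (∀ s, PDiv (D s) p M) →
      ∀ (c : ℕ) (hc : Squarefree c ∧ ∀ q ∈ c.primeFactors,
        Zhang2014.IsKolyvaginPrime N W K p q ∧ M + 1 ≤ Zhang2014.kolyvaginIndex W p q),
      ¬ PDiv (D ⟨c, hc⟩) p (M + 1) →
      ∃ s : {m : ℕ // Squarefree m ∧ ∀ q ∈ m.primeFactors,
          Zhang2014.IsKolyvaginPrime N W K p q ∧ M + 1 ≤ Zhang2014.kolyvaginIndex W p q},
        (∀ q ∈ s.1.primeFactors, e ≤ Zhang2014.kolyvaginIndex W p q) ∧ ¬ PDiv (D s) p (M + 1)) :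
    ∀ (M e : ℕ) (n : ℕ) (d : KolyvaginHeegnerData Dt β ι n), Squarefree n →
      (∀ ℓ ∈ n.primeFactors, Zhang2014.IsKolyvaginPrime N W K p ℓ ∧ M + 1 ≤ Zhang2014.kolyvaginIndex W p ℓ) →
      (∀ (n' : ℕ) (d' : KolyvaginHeegnerData Dt β ι n'), Squarefree n' →
        (∀ ℓ ∈ n'.primeFactors, Zhang2014.IsKolyvaginPrime N W K p ℓ ∧ M + 1 ≤ Zhang2014.kolyvaginIndex W p ℓ) →
        PDiv d' p M) →
      ¬ PDiv d p (M + 1) →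
      ∃ (n' : ℕ) (d' : KolyvaginHeegnerData Dt β ι n'), Squarefree n' ∧
        (∀ ℓ ∈ n'.primeFactors, Zhang2014.IsKolyvaginPrime N W K p ℓ ∧ e ≤ Zhang2014.kolyvaginIndex W p ℓ) ∧
        ¬ PDiv d' p (M + 1) := by
  intro M e n d hn hidx hall hnot
  -- a family of data on the admissible conductors over index `≥ M + 1`, with the given datum at `n`
  let A : Type := {m : ℕ // Squarefree m ∧ ∀ q ∈ m.primeFactors,
    Zhang2014.IsKolyvaginPrime N W K p q ∧ M + 1 ≤ Zhang2014.kolyvaginIndex W p q}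
  let D₀ : ∀ s : A, KolyvaginHeegnerData Dt β ι s.1 :=
    fun s ↦ Classical.choice (hdata s.1 s.2.1 fun q hq ↦ (s.2.2 q hq).1)
  let s₀ : A := ⟨n, hn, hidx⟩
  let D : ∀ s : A, KolyvaginHeegnerData Dt β ι s.1 := Function.update D₀ s₀ d
  have hD₀ : D s₀ = d := Function.update_self s₀ d D₀
  have hallD : ∀ s, PDiv (D s) p M := fun s ↦ hall s.1 (D s) s.2.1 s.2.2
  have hnotD : ¬ PDiv (D ⟨n, hn, hidx⟩) p (M + 1) := by
    change ¬ PDiv (D s₀) p (M + 1)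
    rw [hD₀]; exact hnot
  obtain ⟨s, hdeep, hns⟩ := hsupply M e D hallD n ⟨hn, hidx⟩ hnotD
  exact ⟨s.1, D s, s.2.1, fun q hq ↦ ⟨(s.2.2 q hq).1, hdeep q hq⟩, hns⟩

end Summit.BirchSwinnertonDyer.Rank1Residual.X11b.Three.Koly

end
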